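import Mathlib
import Summits.CriticalPhenomena.CardyFormulaZ2.Theorems.CardySelfRefinementDefs
import Summits.CriticalPhenomena.CardyFormulaZ2.Theorems.CardySelfRefinementRussoDriftModel
import Literature.Probability.Percolation.PivotalCell
import HarnessLib

/-!
# The union bound over the quads for box relevance (stub `stub_boundaryRelevance`, line
`far-field-is-a-quarter-turn`, crux `TrivialSectorRate`, stmt-CriticalPhenomena-10266)

`Rel k m F η u R` is the set-pivotality of the lattice `R`-box about `k•u` for the LOCALISED joint
crossing event `Aloc m F η = {ω | ω ∩ window m F η ∈ A m F η}` of the family `F`.  The naive union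
bound `Rel k m F η u R ⊆ ⋃ i, Rel k 1 (fun _ => F i) η u R` compares events localised with DIFFERENT
windows (the family's window `⋃ i edgesNear(thickening 1 [F i])` against the single quad's) and is
not available configuration by configuration; it does hold on the nearest-neighbour support
`nnSupport` of the laws `M_k(ρ,c)`, where by the sandwich localisation
`mem_configOf_iff_of_sandwich` every localised crossing event agrees with the un-localised one
(`mem_A_iff_inter_window`), and the pivotal witness of a nearest-neighbour configuration for a
box of nearest-neighbour edges is again nearest-neighbour.  This file proves:

* `mem_Aloc_iff_forall_single` — on `nnSupport`, `ω ∈ Aloc m F η ↔ ∀ i, ω ∈ Aloc 1 (F i only) η`;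
* `Rel_inter_nnSupport_subset` — `Rel k m F η u R ∩ nnSupport ⊆ ⋃ i, Rel k 1 (fun _ => F i) η u R`;
* `real_Rel_le_sum_single` (registered helper) — the union bound in measure:
  `M_k(ρ,c)(Rel k m F η u R) ≤ ∑ i, M_k(ρ,c)(Rel k 1 (fun _ => F i) η u R)` for all parameters;
  it reduces the per-box relevance inputs (corner bound, two-scale decay) of
  `boundaryRelevance_small_of_twoScale` for a family to the same inputs for its single quads.
-/

noncomputable section

namespace Summit.CriticalPhenomena.CardyFormulaZ2.Theorems.CardySelfRefinement.FarField

open scoped Topology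
open Filter Set MeasureTheory
open Literature.Probability.LatticeModels Literature.Probability.Percolation
open Literature.Probability.Percolation.QuadCrossing
open Summit.CriticalPhenomena.CardyFormulaZ2.Theses.CardySelfRefinement

/-- On the nearest-neighbour support, the localised joint crossing event of the family is the
intersection of the localised crossing events of its quads (both agree with the un-localised
events there, `mem_A_iff_inter_window`). -/
theorem mem_Aloc_iff_forall_single {m : ℕ} (F : Fin m → Quad (univ : Set ℂ)) (η : ℝ)
    {ω : BondConfig (Site 2)} (hω : ω ∈ nnSupport) :
    ω ∈ Aloc m F η ↔ ∀ i, ω ∈ Aloc 1 (fun _ : Fin 1 => F i) η := by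
  have h1 : ω ∈ Aloc m F η ↔ ω ∈ A m F η := (mem_A_iff_inter_window F η hω).symm
  have h2 : ∀ i, (ω ∈ Aloc 1 (fun _ : Fin 1 => F i) η ↔ ω ∈ A 1 (fun _ : Fin 1 => F i) η) :=
    fun i => (mem_A_iff_inter_window (fun _ : Fin 1 => F i) η hω).symm
  simp only [h1, h2, A, Set.mem_setOf_eq]
  exact ⟨fun h i _ => h i, fun h i => h i 0⟩

/-- **Union bound over the quads, on the nearest-neighbour support.**  A nearest-neighbour
configuration for which the `R`-box about `k•u` is relevant for the family's localised joint
crossing event has the box relevant for the localised crossing event of one of the quads (the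
pivotal witness differs from `ω` only on `boxEdgesAt ⊆ E(ℤ²)`, so it is nearest-neighbour too, and
`mem_Aloc_iff_forall_single` applies to both). -/
theorem Rel_inter_nnSupport_subset (k m : ℕ) (F : Fin m → Quad (univ : Set ℂ)) (η : ℝ)
    (u : Site 2) (R : ℕ) :
    Rel k m F η u R ∩ nnSupport ⊆ ⋃ i, Rel k 1 (fun _ : Fin 1 => F i) η u R := by
  rintro ω ⟨hω, hnn⟩
  obtain ⟨ω', hagree, hflip⟩ := (isPivotalOn_iff _ _ _).1 hω
  -- the witness is nearest-neighbour as well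
  have hnn' : ω' ∈ nnSupport := by
    intro e he
    by_cases heC : e ∈ boxEdgesAt (ctr k u) R
    · exact heC.1
    · exact hnn ((hagree e heC).1 he)
  rw [mem_Aloc_iff_forall_single F η hnn', mem_Aloc_iff_forall_single F η hnn] at hflip
  by_contra hnone
  rw [Set.mem_iUnion, not_exists] at hnone
  refine hflip (forall_congr' fun i => ?_)
  by_contra hi
  exact hnone i ((isPivotalOn_iff _ _ _).2 ⟨ω', hagree, hi⟩)

/-- **THE UNION BOUND OVER THE QUADS FOR BOX RELEVANCE** (registered helper of
`stub_boundaryRelevance`): for every parameter point, `M_k(ρ,c)(Rel k m F η u R)` is at most the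
sum over the quads of the relevance masses of the same box for the single-quad families
`fun _ : Fin 1 => F i` (`M_k` lives on `nnSupport`, where `Rel_inter_nnSupport_subset` holds). -/
theorem real_Rel_le_sum_single (k m : ℕ) (F : Fin m → Quad (univ : Set ℂ)) (η ρ c : ℝ)
    (u : Site 2) (R : ℕ) :
    (M k ρ c).real (Rel k m F η u R) ≤
      ∑ i, (M k ρ c).real (Rel k 1 (fun _ : Fin 1 => F i) η u R) := by
  haveI := isProbabilityMeasure_M k ρ c
  calc (M k ρ c).real (Rel k m F η u R) = (M k ρ c).real (Rel k m F η u R ∩ nnSupport) := by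
        simp only [Measure.real, ← M_eq_inter_nnSupport k ρ c]
    _ ≤ (M k ρ c).real (⋃ i, Rel k 1 (fun _ : Fin 1 => F i) η u R) :=
        measureReal_mono (Rel_inter_nnSupport_subset k m F η u R) (measure_ne_top _ _)
    _ ≤ ∑ i, (M k ρ c).real (Rel k 1 (fun _ : Fin 1 => F i) η u R) :=
        measureReal_iUnion_fintype_le _

end Summit.CriticalPhenomena.CardyFormulaZ2.Theorems.CardySelfRefinement.FarField

end
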